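import Literature.MathematicalPhysics.KineticTheory.CollisionWindowCompensator
import HarnessLib

/-!
# Window counts and coarse states along the flow: the shift identities

Topic `Literature/MathematicalPhysics/KineticTheory` — companion of `CollisionWindowCompensator.lean` (windows, the windowed
collision count `windowCollisions`, the coarse state at a window start `coarseStateAt`).  On the good set of a hard-sphere flow
the orbit of `Φ_{kw} z` at time `u` is the orbit of `z` at time `u + kw` (`HardSphereFlow.flow_add`), so the collision times
of a sphere along the shifted orbit are the translated collision times, the count in window `k` of `z` is the count in
window `0` of `Φ_{kw} z`, and the coarse state at the start of window `k` of `z` is the coarse state at the start of window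
`0` of `Φ_{kw} z`.  These are the bookkeeping identities behind every STATIONARITY step (rung 0: the constant-profile local
Gibbs law is invariant under `Φ_{kw}`, so window-`k` statistics have the law of window-`0` statistics) of the crux line
`Sketch` of `InformationPercolationEngine.CollisionRate` (stmt-AtomisticToContinuum-13481; its reduction stubs
`stub_hazardFairConst_of_variance`, `stub_windowCountSquareTightConst`, `stub_mesoscaleRegularityConst`).

* `collisionTimesOf_flow_shift` — `collisionTimesOf (orbit of Φ_s z) i = (· + s) ⁻¹' collisionTimesOf (orbit of z) i` on the
  good set;
* `ncard_collisionTimesOf_flow_shift_inter_Ico` — the count of the shifted orbit in `[b, c)` is the count of the original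
  orbit in `[b + s, c + s)`;
* `windowCollisions_eq_windowCollisions_zero_flow` — `D_{i,k}(z) = D_{i,0}(Φ_{kw} z)` for good `z`;
* `coarseStateAt_eq_coarseStateAt_zero_flow` — `p_k(z) = p_0(Φ_{kw} z)` for good `z`; and the pointwise forms at a general
  shift.

## References

* I. Gallagher, L. Saint-Raymond, B. Texier, *From Newton to Boltzmann* (2013), §4.1 (the hard-sphere flow as a
  one-parameter group on the good set).  [GST2013]

## Not here

No measure: the stationarity statements themselves (`∫ F(D_{i,k}) dG' = ∫ F(D_{i,0}) dG'` for an invariant `G'`) combine these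
identities with the invariance of the constant-profile local Gibbs law, which is problem-side
(`Theorems.measurePreserving_flow_localGibbsLaw_const`).
-/

noncomputable section

open scoped BigOperators Classical
open Set MeasureTheory
open Literature.Analysis.FluidPDE

namespace Literature.MathematicalPhysics.KineticTheory

variable {σ : ℝ} {N : ℕ} (Φ : HardSphereFlow (Torus.geometry (Fin 3)) (hsDiameter σ N) (N + 1))

/-- **Collision times of a sphere along a shifted orbit**: for good `z`, the collision times of `i` along the orbit of
`Φ_s z` are the collision times of `i` along the orbit of `z`, translated by `−s`
(`u ∈ CT_i(Φ_s z) ↔ u + s ∈ CT_i(z)`). [cite: GST2013, §4.1] -/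
theorem collisionTimesOf_flow_shift {z : Config (N + 1) (Fin 3) T3} (hz : z ∈ Φ.good) (s : ℝ) (i : Fin (N + 1)) :
    collisionTimesOf (Torus.geometry (Fin 3)) (hsDiameter σ N) (fun u => Φ.flow u (Φ.flow s z)) i =
      (fun u => u + s) ⁻¹' collisionTimesOf (Torus.geometry (Fin 3)) (hsDiameter σ N) (fun u => Φ.flow u z) i := by
  ext u
  simp only [mem_preimage, mem_collisionTimesOf]
  rw [← Φ.flow_add u s z hz]

/-- **Counting along a shifted orbit**: for good `z`, the number of collision times of `i` along the orbit of `Φ_s z` in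
`[b, c)` equals the number along the orbit of `z` in `[b + s, c + s)`. [folklore] -/
theorem ncard_collisionTimesOf_flow_shift_inter_Ico {z : Config (N + 1) (Fin 3) T3} (hz : z ∈ Φ.good) (s b c : ℝ)
    (i : Fin (N + 1)) :
    (collisionTimesOf (Torus.geometry (Fin 3)) (hsDiameter σ N) (fun u => Φ.flow u (Φ.flow s z)) i ∩ Set.Ico b c).ncard =
      (collisionTimesOf (Torus.geometry (Fin 3)) (hsDiameter σ N) (fun u => Φ.flow u z) i ∩ Set.Ico (b + s) (c + s)).ncard := by
  rw [collisionTimesOf_flow_shift Φ hz s i]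
  set S := collisionTimesOf (Torus.geometry (Fin 3)) (hsDiameter σ N) (fun u => Φ.flow u z) i with hS
  have hinj : Function.Injective (fun u : ℝ => u + s) := fun u v h => by simpa using h
  have himage : (fun u : ℝ => u + s) '' ((fun u => u + s) ⁻¹' S ∩ Set.Ico b c) = S ∩ Set.Ico (b + s) (c + s) := by
    ext x
    simp only [mem_image, mem_inter_iff, mem_preimage, mem_Ico]
    constructor
    · rintro ⟨u, ⟨hu, hb, hc⟩, rfl⟩
      exact ⟨hu, by linarith, by linarith⟩
    · rintro ⟨hx, hb, hc⟩
      exact ⟨x - s, ⟨by simpa using hx, by linarith, by linarith⟩, by ring⟩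
  rw [← himage, Set.ncard_image_of_injective _ hinj]

/-- **The window count at a general shift**: for good `z` and any `s`, the number of collision times of `i` along the orbit of
`Φ_s z` in `[0, w)` is the number along the orbit of `z` in `[s, s + w)`. [folklore] -/
theorem ncard_collisionTimesOf_flow_inter_Ico_zero {z : Config (N + 1) (Fin 3) T3} (hz : z ∈ Φ.good) (s w : ℝ)
    (i : Fin (N + 1)) :
    (collisionTimesOf (Torus.geometry (Fin 3)) (hsDiameter σ N) (fun u => Φ.flow u (Φ.flow s z)) i ∩ Set.Ico 0 w).ncard =
      (collisionTimesOf (Torus.geometry (Fin 3)) (hsDiameter σ N) (fun u => Φ.flow u z) i ∩ Set.Ico s (s + w)).ncard := by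
  rw [ncard_collisionTimesOf_flow_shift_inter_Ico Φ hz s 0 w i, zero_add, add_comm w s]

/-- **`D_{i,k}(z) = D_{i,0}(Φ_{kw} z)`**: for good `z`, the windowed collision count of sphere `i` in window `k` along the orbit of
`z` is the count in window `0` along the orbit of `Φ_{kw} z` (`w = windowLen N τ a`; both points are good, so neither side is the
off-good junk `0`). [folklore] -/
theorem windowCollisions_eq_windowCollisions_zero_flow {z : Config (N + 1) (Fin 3) T3} (hz : z ∈ Φ.good) (τ a : ℝ)
    (i : Fin (N + 1)) (k : ℕ) :
    windowCollisions σ N Φ τ a i k z =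
      windowCollisions σ N Φ τ a i 0 (Φ.flow ((k : ℝ) * windowLen N τ a) z) := by
  have hz' : Φ.flow ((k : ℝ) * windowLen N τ a) z ∈ Φ.good := Φ.mapsTo_good _ hz
  unfold windowCollisions window
  rw [if_pos hz, if_pos hz']
  congr 1
  push_cast
  rw [zero_mul, zero_add, one_mul,
    ncard_collisionTimesOf_flow_inter_Ico_zero Φ hz ((k : ℝ) * windowLen N τ a) (windowLen N τ a) i]
  congr 2
  ring

/-- **`p_k(z) = p_0(Φ_{kw} z)`**: for good `z`, the coarse state at the start of window `k` of `z` is the coarse state at the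
start of window `0` of `Φ_{kw} z` (`Φ_0 = id` on the good set). [folklore] -/
theorem coarseStateAt_eq_coarseStateAt_zero_flow {z : Config (N + 1) (Fin 3) T3} (hz : z ∈ Φ.good) (r' τ a : ℝ) (k : ℕ) :
    coarseStateAt σ N Φ r' τ a k z = coarseStateAt σ N Φ r' τ a 0 (Φ.flow ((k : ℝ) * windowLen N τ a) z) := by
  have hz' : Φ.flow ((k : ℝ) * windowLen N τ a) z ∈ Φ.good := Φ.mapsTo_good _ hz
  unfold coarseStateAt
  push_cast
  rw [zero_mul, Φ.flow_zero _ hz']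

/-- The coarse state at the start of window `0` of a good point is its own coarse-graining. [folklore] -/
theorem coarseStateAt_zero_of_mem_good {z : Config (N + 1) (Fin 3) T3} (hz : z ∈ Φ.good) (r' τ a : ℝ) :
    coarseStateAt σ N Φ r' τ a 0 z = coarseConfig (Torus.coarseCell r') z := by
  unfold coarseStateAt
  push_cast
  rw [zero_mul, Φ.flow_zero _ hz]

/-- **The coarse state at window `k` is the coarse-graining of `Φ_{kw} z`** (definitional, no good-set hypothesis). [folklore] -/
theorem coarseStateAt_eq_coarseConfig_flow (r' τ a : ℝ) (k : ℕ) (z : Config (N + 1) (Fin 3) T3) :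
    coarseStateAt σ N Φ r' τ a k z = coarseConfig (Torus.coarseCell r') (Φ.flow ((k : ℝ) * windowLen N τ a) z) :=
  rfl

/-- **Measurability of the window count is shift-invariant in form**: the map `z ↦ D_{i,0}(Φ_{kw} z)` is measurable as soon as
`D_{i,0}` is (composition with the measurable time-`kw` map). [folklore] -/
theorem measurable_windowCollisions_zero_comp_flow {τ a : ℝ} {i : Fin (N + 1)}
    (h : Measurable (windowCollisions σ N Φ τ a i 0)) (k : ℕ) :
    Measurable (fun z => windowCollisions σ N Φ τ a i 0 (Φ.flow ((k : ℝ) * windowLen N τ a) z)) :=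
  h.comp (Φ.measurable_flow _)

/-- **Almost-everywhere form** of `D_{i,k} = D_{i,0} ∘ Φ_{kw}` for any measure that does not see the bad set. [folklore] -/
theorem windowCollisions_ae_eq_comp_flow (μ : Measure (Config (N + 1) (Fin 3) T3)) (hμ : μ Φ.goodᶜ = 0) (τ a : ℝ)
    (i : Fin (N + 1)) (k : ℕ) :
    (fun z => windowCollisions σ N Φ τ a i k z) =ᵐ[μ]
      fun z => windowCollisions σ N Φ τ a i 0 (Φ.flow ((k : ℝ) * windowLen N τ a) z) := by
  have : ∀ᵐ z ∂μ, z ∈ Φ.good := by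
    rw [ae_iff]
    exact hμ
  filter_upwards [this] with z hz
  exact windowCollisions_eq_windowCollisions_zero_flow Φ hz τ a i k

/-- **Almost-everywhere form** of `p_k = p_0 ∘ Φ_{kw}` for any measure that does not see the bad set. [folklore] -/
theorem coarseStateAt_ae_eq_comp_flow (μ : Measure (Config (N + 1) (Fin 3) T3)) (hμ : μ Φ.goodᶜ = 0) (r' τ a : ℝ)
    (k : ℕ) :
    (fun z => coarseStateAt σ N Φ r' τ a k z) =ᵐ[μ]
      fun z => coarseStateAt σ N Φ r' τ a 0 (Φ.flow ((k : ℝ) * windowLen N τ a) z) := by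
  have : ∀ᵐ z ∂μ, z ∈ Φ.good := by
    rw [ae_iff]
    exact hμ
  filter_upwards [this] with z hz
  exact coarseStateAt_eq_coarseStateAt_zero_flow Φ hz r' τ a k

end Literature.MathematicalPhysics.KineticTheory

end
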